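import Summits.PneNP.PneNP.Theorems.OneSliceSliceTargetSplitStability

/-!
# `MonotoneContinuation` (stmt-PneNP-18471, route PneNP/OneSlice) — negative-side lemmas II-A: local functions are
# transport-stable

Part A of the star-parity witness showing that the closeness hypothesis of the crux
`Summit.PneNP.PneNP.Theses.OneSlice.MonotoneContinuation` is load-bearing (assembled in `ClosenessLoadBearing.lean`):
a Boolean function determined by the coordinates in an edge set `T` (`LocalOn T f`) moves under the slice-`j` transport `T_j`
of the split files by at most `#T·W/C(n,2) + C(n,2)p(1-p)/t²` in `L¹(G(n,p))`, whenever the edge counts split into good ones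
within `W` of `j` and the others at distance `≥ t` from the mean (`l1_transport_local_le`). This is the analogue of the split's
stability of `CLIQUE_k` (`OneSliceSliceTargetSplitStability`) with `C(k,2)` replaced by the AVERAGE star degree: a comparable
pair separates a `T`-local `f` only if a deleted edge lies in `T` (`card_bad_nbhd_le_local`), and `Σ_{z ∈ slice b} #(T ∩ z) =
#T·C(N-1,b-1)` (`sum_card_inter_supp_le`), whence the per-slice bound `C(N,i)·#T·|i-j|/N` (`sliceSum_transport_local_le`).

Refuter seat refuter-cdisprove-stmt-PneNP-18471-0 (cdisprove), 2026-08-17; work file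
`Summits/PneNP/PneNP/Cruxes/MonotoneContinuation/Disproof.lean`.
-/

set_option linter.dupNamespace false

namespace Summit.PneNP.PneNP.Theorems.MonotoneContinuation.Negative

open Literature.Computability.Complexity hiding supp mem_supp
open Finset hiding slice
open Filter hiding mem_sdiff
open Classical
open Summit.PneNP.PneNP.Theorems.ConstantBand.Negative (Edge thr Central central_thr slice)
open Summit.PneNP.PneNP.Theorems.SliceACZero.Negative (supp mem_supp card_supp supp_injective supp_indicator
  card_slice_supset_le)
open Summit.PneNP.PneNP.Theorems.SingleThreshold.Negative (pc pc_nonneg pc_le_one)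
open Summit.PneNP.PneNP.Theorems.SliceTargetSplit (Comp nbhd mem_nbhd transport ind l1 nbhdCard
  ind_nonneg ind_le_one l1_triangle l1_eq_sum_slices card_nbhd choose_mul_nbhdCard nbhdCard_pos
  supp_subset_of_comp_of_le abs_transport_ind_sub_ind_le_one sliceSum_abs_transport_ind_sub_ind_le
  sum_card_filter_nbhd_comm choose_pred_mul_le comp_comm card_nbhd_filter_false_le)
open Summit.PneNP.PneNP.Theorems (binomialWeight_sum_range binomialWeight_nonneg binomialWeight_tail_le card_slice
  eventually_window tendsto_mean central_add_le)

noncomputable section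

variable {n : ℕ}

/-- `f` is determined by the coordinates in `T`. [folklore] -/
def LocalOn (T : Finset (Edge n)) (f : (Edge n → Bool) → Bool) : Prop :=
  ∀ x y : Edge n → Bool, (∀ e ∈ T, x e = y e) → f x = f y

/-! ### Part A. Transport stability of local functions -/

/-- On its own slice a vector's neighbourhood is itself. [folklore] -/
theorem nbhd_self {j : ℕ} {y : Edge n → Bool} (hy : edgeCount y = j) : nbhd j y = {y} := by
  ext x
  rw [mem_nbhd, mem_singleton]
  constructor
  · rintro ⟨hx, hcomp⟩
    have h1 : supp x ⊆ supp y := supp_subset_of_comp_of_le hcomp (by rw [hx, hy])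
    have h2 : supp y ⊆ supp x := supp_subset_of_comp_of_le (comp_comm.1 hcomp) (by rw [hx, hy])
    exact supp_injective (subset_antisymm h1 h2)
  · rintro rfl
    exact ⟨hy, Or.inl fun e he => he⟩

/-- On its own slice the transport is the identity. [folklore] -/
theorem transport_self {j : ℕ} (g : (Edge n → Bool) → ℝ) {y : Edge n → Bool} (hy : edgeCount y = j) :
    transport j g y = g y := by
  rw [transport, nbhd_self hy, sum_singleton, card_singleton, Nat.cast_one, div_one]

/-- **Separating a vector from its lower neighbourhood costs a deleted `T`-edge.** For a `T`-local `f` and `z` of weight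
`b ≥ a`, the slice-`a` vectors below `z` on which `f` differs from `f z` number at most `#(T ∩ supp z) · C(b-1, a)`. [folklore] -/
theorem card_bad_nbhd_le_local {T : Finset (Edge n)} {f : (Edge n → Bool) → Bool} (hf : LocalOn T f) {a b : ℕ}
    (hab : a ≤ b) {z : Edge n → Bool} (hz : edgeCount z = b) :
    #((nbhd a z).filter fun x => f x ≠ f z) ≤ #(T ∩ supp z) * (b - 1).choose a := by
  have hsub : (nbhd a z).filter (fun x => f x ≠ f z) ⊆
      (T ∩ supp z).biUnion fun e => (nbhd a z).filter fun x => x e = false := by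
    intro x hx
    rw [mem_filter] at hx
    obtain ⟨hxn, hne⟩ := hx
    have hxn' := mem_nbhd.1 hxn
    have hxz : supp x ⊆ supp z := supp_subset_of_comp_of_le hxn'.2 (by rw [hxn'.1, hz]; exact hab)
    have hex : ¬ ∀ e ∈ T, x e = z e := fun h => hne (hf x z h)
    push Not at hex
    obtain ⟨e, heT, hxe⟩ := hex
    have hxe' : x e = false := by
      cases hx2 : x e
      · rfl
      · exact absurd ((mem_supp.1 (hxz (mem_supp.2 hx2))) ▸ hx2) hxe
    have hze : z e = true := by
      cases hz2 : z e
      · exact absurd (hxe'.trans hz2.symm) hxe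
      · rfl
    rw [mem_biUnion]
    exact ⟨e, mem_inter.2 ⟨heT, mem_supp.2 hze⟩, mem_filter.2 ⟨hxn, hxe'⟩⟩
  calc #((nbhd a z).filter fun x => f x ≠ f z)
      ≤ #((T ∩ supp z).biUnion fun e => (nbhd a z).filter fun x => x e = false) := card_le_card hsub
    _ ≤ ∑ e ∈ T ∩ supp z, #((nbhd a z).filter fun x => x e = false) := card_biUnion_le
    _ ≤ ∑ e ∈ T ∩ supp z, (b - 1).choose a := sum_le_sum fun e he => by
        rw [← hz]
        exact card_nbhd_filter_false_le (hz ▸ hab) (mem_supp.1 (mem_inter.1 he).2)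
    _ = #(T ∩ supp z) * (b - 1).choose a := by rw [sum_const, smul_eq_mul]

/-- **Average star degree on a slice**: `Σ_{z ∈ slice b} #(T ∩ supp z) ≤ #T · C(N-1, b-1)` (`b ≥ 1`; in fact equality). [folklore] -/
theorem sum_card_inter_supp_le (T : Finset (Edge n)) {b : ℕ} (hb : 1 ≤ b) :
    ∑ z ∈ slice n b, (#(T ∩ supp z) : ℝ) ≤ #T * (((n.choose 2 - 1).choose (b - 1) : ℕ) : ℝ) := by
  have hnat : ∑ z ∈ slice n b, #(T ∩ supp z) ≤ #T * (n.choose 2 - 1).choose (b - 1) := by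
    have h1 : ∀ z : Edge n → Bool, #(T ∩ supp z) = ∑ e ∈ T, if z e = true then 1 else 0 := fun z => by
      have : T ∩ supp z = T.filter fun e => z e = true := by
        ext e
        simp only [mem_inter, mem_supp, mem_filter]
      rw [this, card_filter]
    simp_rw [h1]
    rw [sum_comm]
    calc ∑ e ∈ T, ∑ z ∈ slice n b, (if z e = true then 1 else 0)
        = ∑ e ∈ T, #((slice n b).filter fun z => z e = true) := sum_congr rfl fun e _ => by rw [sum_boole]; rfl
      _ ≤ ∑ e ∈ T, (n.choose 2 - 1).choose (b - 1) := sum_le_sum fun e _ => by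
          have h := card_slice_supset_le (n := n) b ({e} : Finset (Edge n)) (by simpa using hb)
          simp only [card_singleton, mem_singleton, forall_eq] at h
          refine le_trans (le_of_eq ?_) h
          congr 1
          ext z
          simp only [slice, mem_filter, mem_univ, true_and]
      _ = #T * (n.choose 2 - 1).choose (b - 1) := by rw [sum_const, smul_eq_mul]
  exact_mod_cast hnat

/-- Pascal's absorption identity in the form used: `N · C(N-1, i-1) = C(N, i) · i` (`N, i ≥ 1`), over `ℝ`. [folklore] -/
theorem choose_pred_pred_eq {N i : ℕ} (hN : 1 ≤ N) (hi : 1 ≤ i) :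
    (((N - 1).choose (i - 1) : ℕ) : ℝ) = (N.choose i : ℝ) * i / N := by
  have h := Nat.add_one_mul_choose_eq (N - 1) (i - 1)
  rw [Nat.sub_add_cancel hN, Nat.sub_add_cancel hi] at h
  have hN0 : (N : ℝ) ≠ 0 := by exact_mod_cast (show N ≠ 0 by omega)
  rw [eq_div_iff hN0]
  have := congrArg (Nat.cast (R := ℝ)) h
  push_cast at this
  linarith

/-- **Per-slice stability of a local function.** For slices `i, j ≤ C(n,2)`, the slice-`i` sum of the transport error of
`𝟙[f]` is at most `C(N,i) · #T · |i - j| / N` (`N = C(n,2)`). [folklore] -/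
theorem sliceSum_transport_local_le {T : Finset (Edge n)} {f : (Edge n → Bool) → Bool} (hf : LocalOn T f) {i j : ℕ}
    (hi : i ≤ n.choose 2) (hj : j ≤ n.choose 2) :
    ∑ y ∈ slice n i, |transport j (ind f) y - ind f y|
      ≤ ((n.choose 2).choose i : ℝ) * (#T * |(i : ℝ) - j| / (n.choose 2 : ℕ)) := by
  set N := n.choose 2 with hN
  rcases eq_or_ne i j with rfl | hne
  · have h0 : ∑ y ∈ slice n i, |transport i (ind f) y - ind f y| = 0 :=
      sum_eq_zero fun y hy => by rw [transport_self _ (mem_filter.1 hy).2, sub_self, abs_zero]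
    rw [h0]
    positivity
  have hN1 : 1 ≤ N := by omega
  have hN0 : (0 : ℝ) < N := by exact_mod_cast hN1
  have hD := nbhdCard_pos hi hj
  have hD' : (0 : ℝ) < nbhdCard N i j := by exact_mod_cast hD
  have hT0 : (0 : ℝ) ≤ #T := Nat.cast_nonneg _
  refine (sliceSum_abs_transport_ind_sub_ind_le f hi hj).trans ?_
  rw [div_le_iff₀ hD']
  rcases lt_or_gt_of_ne hne with hij | hji
  · -- upper slice `i < j`: double count from the slice-`j` side
    have hj1 : 1 ≤ j := by omega
    have hrec : ((N.choose i : ℕ) : ℝ) * (nbhdCard N i j : ℝ) = (N.choose j : ℝ) * (j.choose i : ℝ) := by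
      have := choose_mul_nbhdCard N i j
      rw [show nbhdCard N j i = j.choose i by rw [nbhdCard, if_pos hij.le]] at this
      exact_mod_cast this
    have habs : |(i : ℝ) - j| = (j : ℝ) - i := by
      rw [abs_sub_comm]; exact abs_of_nonneg (by simpa using (Nat.cast_le (α := ℝ)).2 hij.le)
    have hkey := choose_pred_mul_le hij.le (L := (j : ℝ)) (Nat.cast_nonneg _) le_rfl
    have hid := choose_pred_pred_eq hN1 hj1
    have hbad : ∑ y ∈ slice n i, (#((nbhd j y).filter fun x => f x ≠ f y) : ℝ)
        ≤ ((j - 1).choose i : ℝ) * (#T * (((N - 1).choose (j - 1) : ℕ) : ℝ)) := by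
      rw [sum_card_filter_nbhd_comm i j (fun x y => f x ≠ f y)]
      calc ∑ x ∈ slice n j, (#((nbhd i x).filter fun y => f x ≠ f y) : ℝ)
          ≤ ∑ x ∈ slice n j, (#(T ∩ supp x) : ℝ) * ((j - 1).choose i : ℕ) := sum_le_sum fun x hx => by
              rw [filter_congr (fun y _ => ne_comm)]
              exact_mod_cast card_bad_nbhd_le_local hf hij.le (mem_filter.1 hx).2
        _ = ((j - 1).choose i : ℝ) * ∑ x ∈ slice n j, (#(T ∩ supp x) : ℝ) := by rw [mul_sum]; exact sum_congr rfl fun _ _ => by ring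
        _ ≤ ((j - 1).choose i : ℝ) * (#T * (((N - 1).choose (j - 1) : ℕ) : ℝ)) :=
            mul_le_mul_of_nonneg_left (sum_card_inter_supp_le T hj1) (Nat.cast_nonneg _)
    refine hbad.trans ?_
    rw [hid, habs]
    -- `C(j-1,i)·#T·C(N,j)·j/N ≤ C(N,i)·(#T·(j-i)/N)·D = (#T·(j-i)/N)·C(N,j)·C(j,i)`
    have hCj : 0 ≤ ((N.choose j : ℕ) : ℝ) := Nat.cast_nonneg _
    calc ((j - 1).choose i : ℝ) * (#T * ((N.choose j : ℝ) * j / N))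
        = #T * (N.choose j : ℝ) / N * ((((j - 1).choose i : ℕ) : ℝ) * j) := by ring
      _ ≤ #T * (N.choose j : ℝ) / N * ((j.choose i : ℝ) * ((j : ℝ) - i)) :=
          mul_le_mul_of_nonneg_left hkey (by positivity)
      _ = #T * ((j : ℝ) - i) / N * ((N.choose j : ℝ) * (j.choose i : ℝ)) := by ring
      _ = ((N.choose i : ℕ) : ℝ) * (#T * ((j : ℝ) - i) / N) * (nbhdCard N i j : ℝ) := by rw [← hrec]; ring
  · -- lower slice `j < i`
    have hi1 : 1 ≤ i := by omega
    have hDij : (nbhdCard N i j : ℝ) = (i.choose j : ℝ) := by rw [nbhdCard, if_pos hji.le]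
    have habs : |(i : ℝ) - j| = (i : ℝ) - j := abs_of_nonneg (by simpa using (Nat.cast_le (α := ℝ)).2 hji.le)
    have hkey := choose_pred_mul_le hji.le (L := (i : ℝ)) (Nat.cast_nonneg _) le_rfl
    have hid := choose_pred_pred_eq hN1 hi1
    have hbad : ∑ y ∈ slice n i, (#((nbhd j y).filter fun x => f x ≠ f y) : ℝ)
        ≤ ((i - 1).choose j : ℝ) * (#T * (((N - 1).choose (i - 1) : ℕ) : ℝ)) := by
      calc ∑ y ∈ slice n i, (#((nbhd j y).filter fun x => f x ≠ f y) : ℝ)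
          ≤ ∑ y ∈ slice n i, (#(T ∩ supp y) : ℝ) * ((i - 1).choose j : ℕ) := sum_le_sum fun y hy => by
              exact_mod_cast card_bad_nbhd_le_local hf hji.le (mem_filter.1 hy).2
        _ = ((i - 1).choose j : ℝ) * ∑ y ∈ slice n i, (#(T ∩ supp y) : ℝ) := by rw [mul_sum]; exact sum_congr rfl fun _ _ => by ring
        _ ≤ ((i - 1).choose j : ℝ) * (#T * (((N - 1).choose (i - 1) : ℕ) : ℝ)) :=
            mul_le_mul_of_nonneg_left (sum_card_inter_supp_le T hi1) (Nat.cast_nonneg _)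
    refine hbad.trans ?_
    rw [hid, habs, hDij]
    calc ((i - 1).choose j : ℝ) * (#T * ((N.choose i : ℝ) * i / N))
        = #T * (N.choose i : ℝ) / N * ((((i - 1).choose j : ℕ) : ℝ) * i) := by ring
      _ ≤ #T * (N.choose i : ℝ) / N * ((i.choose j : ℝ) * ((i : ℝ) - j)) :=
          mul_le_mul_of_nonneg_left hkey (by positivity)
      _ = ((N.choose i : ℕ) : ℝ) * (#T * ((i : ℝ) - j) / N) * (i.choose j : ℝ) := by ring

/-- **`L¹(G(n,p))` stability of a local function under slice transport.** If the edge counts split into GOOD ones within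
`W` of `j` and the others at distance `≥ t > 0` from the mean, then
`‖T_j𝟙[f] − 𝟙[f]‖_{L¹(G(n,p))} ≤ #T·W/C(n,2) + C(n,2)p(1-p)/t²`. [folklore] -/
theorem l1_transport_local_le {T : Finset (Edge n)} {f : (Edge n → Bool) → Bool} (hf : LocalOn T f) {j : ℕ} {p : ℝ}
    (hp0 : 0 ≤ p) (hp1 : p ≤ 1) (hj : j ≤ n.choose 2) (Good : ℕ → Prop) {W t : ℝ} (hW : 0 ≤ W)
    (ht : 0 < t) (hgood : ∀ i, Good i → |(i : ℝ) - j| ≤ W)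
    (hbad : ∀ i, i ≤ n.choose 2 → ¬ Good i → t ≤ |(i : ℝ) - (n.choose 2 : ℕ) * p|) :
    l1 n p (transport j (ind f)) (ind f) ≤ #T * W / (n.choose 2 : ℕ) + (n.choose 2 : ℕ) * p * (1 - p) / t ^ 2 := by
  set N := n.choose 2 with hN
  set b : ℕ → ℝ := fun i => (N.choose i : ℝ) * p ^ i * (1 - p) ^ (N - i) with hbdef
  have hb : ∀ i, b i = (N.choose i : ℝ) * p ^ i * (1 - p) ^ (N - i) := fun i => rfl
  set E : ℕ → ℝ := fun i => ∑ y ∈ slice n i, |transport j (ind f) y - ind f y| with hE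
  have hEall : ∀ i, E i ≤ (N.choose i : ℝ) := fun i => by
    calc E i ≤ ∑ y ∈ slice n i, (1 : ℝ) := sum_le_sum fun y _ => abs_transport_ind_sub_ind_le_one f y
      _ = (N.choose i : ℝ) := by rw [sum_const, nsmul_eq_mul, mul_one, card_slice]
  have hK0 : 0 ≤ #T * W / (N : ℝ) := by positivity
  have hEgood : ∀ i, i ≤ N → Good i → E i ≤ (N.choose i : ℝ) * (#T * W / N) := fun i hi hgi => by
    refine (sliceSum_transport_local_le hf hi hj).trans ?_
    refine mul_le_mul_of_nonneg_left ?_ (Nat.cast_nonneg _)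
    exact div_le_div_of_nonneg_right (mul_le_mul_of_nonneg_left (hgood i hgi) (Nat.cast_nonneg _))
      (Nat.cast_nonneg _)
  have hq : ∀ i, 0 ≤ p ^ i * (1 - p) ^ (N - i) := fun i =>
    mul_nonneg (pow_nonneg hp0 _) (pow_nonneg (sub_nonneg.2 hp1) _)
  rw [l1_eq_sum_slices]
  change ∑ i ∈ range (N + 1), p ^ i * (1 - p) ^ (N - i) * E i ≤ _
  rw [← sum_filter_add_sum_filter_not (range (N + 1)) Good]
  refine add_le_add ?_ ?_
  · calc ∑ i ∈ (range (N + 1)).filter Good, p ^ i * (1 - p) ^ (N - i) * E i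
        ≤ ∑ i ∈ (range (N + 1)).filter Good, b i * (#T * W / N) := by
          refine sum_le_sum fun i hi => ?_
          obtain ⟨hir, hgi⟩ := mem_filter.1 hi
          have hiN : i ≤ N := Nat.lt_succ_iff.1 (mem_range.1 hir)
          calc p ^ i * (1 - p) ^ (N - i) * E i ≤ p ^ i * (1 - p) ^ (N - i) * ((N.choose i : ℝ) * (#T * W / N)) :=
                mul_le_mul_of_nonneg_left (hEgood i hiN hgi) (hq i)
            _ = b i * (#T * W / N) := by rw [hb]; ring
      _ = (∑ i ∈ (range (N + 1)).filter Good, b i) * (#T * W / N) := by rw [sum_mul]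
      _ ≤ 1 * (#T * W / N) := by
          refine mul_le_mul_of_nonneg_right ?_ hK0
          calc ∑ i ∈ (range (N + 1)).filter Good, b i ≤ ∑ i ∈ range (N + 1), b i :=
                sum_le_sum_of_subset_of_nonneg (filter_subset _ _) fun i _ _ => binomialWeight_nonneg hb hp0 hp1 i
            _ = 1 := binomialWeight_sum_range hb
      _ = #T * W / N := one_mul _
  · calc ∑ i ∈ (range (N + 1)).filter (fun i => ¬ Good i), p ^ i * (1 - p) ^ (N - i) * E i
        ≤ ∑ i ∈ (range (N + 1)).filter (fun i => ¬ Good i), b i := by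
          refine sum_le_sum fun i _ => ?_
          calc p ^ i * (1 - p) ^ (N - i) * E i ≤ p ^ i * (1 - p) ^ (N - i) * (N.choose i : ℝ) :=
                mul_le_mul_of_nonneg_left (hEall i) (hq i)
            _ = b i := by rw [hb]; ring
      _ = ∑ i ∈ (range (N + 1)).filter (fun i => i ≤ N ∧ ¬ Good i), b i := by
          refine sum_congr (filter_congr fun i hi => ?_) fun _ _ => rfl
          have hiN : i ≤ N := Nat.lt_succ_iff.1 (mem_range.1 hi)
          exact ⟨fun h => ⟨hiN, h⟩, fun h => h.2⟩
      _ ≤ (N : ℝ) * p * (1 - p) / t ^ 2 :=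
          binomialWeight_tail_le hb hp0 hp1 ht (fun i => i ≤ N ∧ ¬ Good i) fun i hi => hbad i hi.1 hi.2

end

end Summit.PneNP.PneNP.Theorems.MonotoneContinuation.Negative
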